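import Literature.AlgebraicGeometry.Motives.AbelianVarietyDihedralIdempotentRelations
import Mathlib.GroupTheory.Perm.Fin
import Mathlib.GroupTheory.SpecificGroups.Alternating
import Mathlib.Data.Fin.VecNotation
import HarnessLib

/-!
# Kani–Rosen's Theorem B for the symmetric groups `S₄ ≅ PGL₂(3)` and `S₅ ≅ PGL₂(5)` EQUIPPED BY THEIR PARTITIONS into
# maximal cyclic subgroups (machine-checked): `X × B_{S₄}² ∼ B_{C₂} × B_{C₃} × B_{C₄}` and Korchmáros–Lia–Timpanella's
# (33) `X × B_{S₅}⁴ ∼ B_{C₄}² × B_{C₅} × B_{C₆}²`, `B_{S₅} = 0 ⟹ X ∼ B_{C₄}² × B_{C₅} × B_{C₆}²` — ALGEBRAIC carrier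

Layer A1/A2 of the Hodge foundations lane (`lit-hodgefound`, row A1-20⁺ · A2, seat p03 generation 24, row g24-#2)
on the ALGEBRAIC carrier `AbelianVariety K` of `Motives/AbelianVariety` — Hom counts over an ARBITRARY field,
isogenies and dimensions over a PERFECT field.  Sequel of `Motives/AbelianVarietyDihedralIdempotentRelations` Part II
(g22-#3: Theorem B "for a group equipped by a partition whose components are sorted into conjugacy classes",
**`sum_card_fiber_mul_finrank_hom_image_eq_of_partition`** — CONSUMED; its Scope (1) said "The partition of
`Sym_5 ≅ PGL(2,5)` into its cyclic subgroups of orders `4`, `5`, `6` (and those of `A_4`, `A_5`, …) are NOT formalised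
here — only the bookkeeping theorem they are fed into"; THIS file supplies the partitions of `S₄` and `S₅`, verified by
the kernel (`decide`), and feeds them in) and of `Motives/AbelianVarietyIsogenyCancellation`
(`isIsogenous_iff_forall_finrank_hom_eq'`, `finrank_hom_biprod`, `finrank_hom_biproduct_const`).  Everything here is
PROVED; the file introduces NO definition and NO named fact (net Literature debt 0): the partition data (generators,
classes, conjugating elements) are literal tables INSIDE the statements of Part A and inside the proofs of Part B.

**v2 (same seat, 2026-08-27, ADD-ONLY Part II = §1″ + §4): the alternating group `A₅ ≅ PSL₂(4) ≅ PSL₂(5)`** on the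
carrier `↥(alternatingGroup (Fin 5))`, equipped by the partition into its `31 = 15 + 10 + 6` subgroups of prime order
(double transpositions, `3`-cycles, `5`-cycles; even conjugators): `a5_pow_tables`, `a5_card_classes`, `a5_card_zpowers`,
`card_alternatingGroup_fin_five`, **`finrank_hom_altFive`**, **`isIsogenous_altFive`** (`X × B_{A₅}² ∼ B_{C₂} × B_{C₃} ×
B_{C₅}`), `dim_altFive`, `isIsogenous_altFive_of_dim_eq_zero`.  Part I is byte-for-byte unchanged except for the one new
`import Mathlib.GroupTheory.SpecificGroups.Alternating` and clause (1) of its Scope.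

## Sources, verbatim

G. Korchmáros, S. Lia, M. Timpanella, *A generalization of Bring's curve in any characteristic* (2021), arXiv
2112.10886 (held text `paper:arxiv-2112.10886`), §10 p. 27: "**Theorem 10.1** (Kani–Rosen). Let `G` be a finite
automorphism group of an algebraic curve `𝒳`. If `G` is equipped by a partition, then the following isogeny relation
holds: **(32)** `J^{t−1}_𝒳 × J^{|G|}_{𝒳/G} ∼ J^{h_1}_{𝒳/H_1} × ⋯ × J^{h_t}_{𝒳/H_t}`, where `H_1, …, H_t` are the
components of the partition and `h_i = |H_i|` for `i = 1, … t`. In fact, the Kani–Rosen theorem applies to `G` as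
`G ≅ Sym_5` and `Sym_5 ≅ PGL(2, 5)` is equipped with a partition whose components form three conjugacy classes of
lengths `15, 6, 10`, namely those consisting of all cyclic subgroups of order `4, 5` and `6`, respectively. […] In our
case, since `V/G` is rational, Theorem 10.1 reads **(33)** `J^{30}_V ∼ J^{60}_{V/C4} × J^{30}_{V/C5} × J^{60}_{V/C6}`."

M. Garonzi, M. L. Dias, *Group partitions of minimal size*, J. Algebra **531** (2019) 1–18 (arXiv 1811.02996, held text
`paper:arxiv-1811.02996`), §1 p0003: "A cover is called a partition of `G` if `H_i ∩ H_j = {1}` whenever `i ≠ j`. […]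
Baer, Kegel and Suzuki proved that a group `G` is partitionable if and only if it is isomorphic to one of: `S_4` (the
symmetric group of degree `4`), a `p`-group with `H_p(G) ≠ G` […], a group of Hughes-Thompson type, a Frobenius group,
`PSL_2(p^m)` with `p^m ≥ 4`, `PGL_2(p^m)` with `p^m ≥ 5` and `p` odd, the Suzuki group `Sz(2^{2m+1})` where `m ≥ 1`";
§4 p0006: "Observe that `S_4 ≅ PGL_2(3)` […] We will think of the group `G = S_4` acting naturally on `{1,2,3,4}`. `G`
has `9` elements of order `2`, `8` elements of order `3` and `6` elements of order `4`. […] the three cyclic subgroups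
of order `4`"; §7 p0012: "We will think of `PGL_2(5)` as of the symmetric group `S_5`. The group `G` has `25` elements
of order `2`, `20` elements of order `3`, `30` elements of order `4`, `24` elements of order `5` and `20` elements of
order `6`."

## Dictionary and what is proved

`S₄ = Equiv.Perm (Fin 4)`, `S₅ = Equiv.Perm (Fin 5)` (points `0, …, n−1`; `swap a b` the transposition `(a b)`,
`swap 0 1 * swap 1 2 = (0 1 2)`, `swap 0 1 * swap 1 2 * swap 2 3 = (0 1 2 3)`, `swap 0 1 * swap 1 2 * swap 3 4 =
(0 1 2)(3 4)` in Mathlib's composition `(f * g) x = f (g x)`); an action on the abelian variety `X` is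
`ρ : Perm (Fin n) →* End X`, `B_H = ε_H(X) = Im N_H` with `End.of N_H = Σ_{h : H} ρ h`, `B_G = Im N_G`,
`End.of N_G = Σ_g ρ g`, as in all predecessors.  THE PARTITIONS: the MAXIMAL CYCLIC subgroups — for `S₄` the `6`
transposition subgroups, the `4` Sylow `3`-subgroups and the `3` cyclic subgroups of order `4` (`6·1 + 4·2 + 3·3 = 23`
non-identity elements); for `S₅` the `15` cyclic subgroups of order `4`, the `6` Sylow `5`-subgroups and the `10`
cyclic subgroups of order `6` (`15·3 + 6·4 + 10·5 = 119`) — each class given by a representative `b_k` and conjugating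
elements `c_j` (components `⟨c_j b_k c_j⁻¹⟩`), on the index sets `Fin 3 ⊕ Fin 10` and `Fin 3 ⊕ Fin 28`.

* Part A (namespace `Literature.AlgebraicGeometry.Motives.SymmetricGroupPartition`, pure group theory, kernel-checked
  by `decide`): **`s4_pow_tables`** / **`s5_pow_tables`** (orders of the generators; every element is a power
  `gen_i ^ n`, `n < |gen_i|`; two distinct components share only `1`), `s4_card_classes` / `s5_card_classes` (class
  lengths `6, 4, 3` / `15, 6, 10`), `s4_card_zpowers` / `s5_card_zpowers` (orders `2, 3, 4` / `4, 5, 6` of the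
  representatives).
* Part B (namespace `Literature.AlgebraicGeometry.Motives.AbelianVariety`): §2 `S₄` — **`finrank_hom_symFour`** (any
  field: `rk Hom(B_{C₂}, B) + rk Hom(B_{C₃}, B) + rk Hom(B_{C₄}, B) = rk Hom(X, B) + 2 rk Hom(B_{S₄}, B)` for every `B`),
  **`isIsogenous_symFour`** (perfect field: `X × B_{S₄}² ∼ B_{C₂} × B_{C₃} × B_{C₄}`), `dim_symFour`
  (`dim X + 2 dim B_{S₄} = dim B_{C₂} + dim B_{C₃} + dim B_{C₄}`), `isIsogenous_symFour_of_dim_eq_zero` (`B_{S₄} = 0 ⟹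
  X ∼ B_{C₂} × B_{C₃} × B_{C₄}`); §3 `S₅` — **`finrank_hom_symFive`** (`2 rk Hom(B_{C₄}, B) + rk Hom(B_{C₅}, B) +
  2 rk Hom(B_{C₆}, B) = rk Hom(X, B) + 4 rk Hom(B_{S₅}, B)`), **`isIsogenous_symFive`** (`X × B_{S₅}⁴ ∼ B_{C₄}² × B_{C₅}
  × B_{C₆}²` — (32)/(33) divided by `30`), `dim_symFive`, **`isIsogenous_symFive_of_dim_eq_zero`** ((33) with `J_{V/G} = 0`:
  `X ∼ B_{C₄}² × B_{C₅} × B_{C₆}²`, "`J_V ∼ J²_{V/C4} × J_{V/C5} × J²_{V/C6}`").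

Method: the tables are fed to `sum_card_fiber_mul_finrank_hom_image_eq_of_partition` (components `inl k` carry the
user's `N_k`, components `inr j` the norm endomorphisms `Σ_{h ∈ ⟨c_j b_k c_j⁻¹⟩} ρ h`; conjugate components contribute
equally), giving `12 (r₂ + r₃ + r₄) = 12 r_X + 24 r_G` resp. `60 r₄ + 30 r₅ + 60 r₆ = 30 r_X + 120 r_G` on the Hom
counts `r_• = rk Hom(B_•, B)`; the isogenies follow from the Hom-count criterion over a perfect field.

Scope (stated, not hidden). (1) Only `S₄` and `S₅` are treated in Part I and `A₅` in Part II (v2) (the other groups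
of the Baer–Kegel–Suzuki list with their Sylow/cyclic partitions — `PSL₂(7)`, `PSL₂(8)`, `PGL₂(7)`, the Suzuki groups, …
— are not; `A₄` and the dihedral / Frobenius / elementary abelian cases are in the sibling files).  (2) The representatives are the specific permutations named above;
any other transposition / `3`-cycle / `4`-cycle (resp. `4`-cycle / `5`-cycle / element of order `6`) gives an isogenous
`B_H` by `finrank_hom_image_norm_eq_of_conj` (`Motives/AbelianVarietyDihedralIdempotentRelations` §1), not restated.
(3) As in all predecessors `J_{X/H}` is replaced by `ε_H(X)`; Hom counts over any field, isogenies over a perfect field.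

## References

* [KorchmarosLiaTimpanella2021] G. Korchmáros, S. Lia, M. Timpanella, *A generalization of Bring's curve in any
  characteristic*, arXiv:2112.10886 (2021), §10 Thm. 10.1 (= Kani–Rosen Thm. B), (32)–(33), p. 27.
* [KaniRosen1989] E. Kani, M. Rosen, *Idempotent relations and factors of Jacobians*, Math. Ann. 284 (1989) 307–327,
  Thm. B.
* [GaronziDias2019] M. Garonzi, M. L. Dias, *Group partitions of minimal size*, J. Algebra 531 (2019) 1–18,
  arXiv:1811.02996, §1 (Baer–Kegel–Suzuki classification), §4 (`S_4 ≅ PGL_2(3)`), §7 (`PGL_2(5) ≅ S_5`).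
* [Paulhus2008] J. Paulhus, *Decomposing Jacobians of curves with extra automorphisms*, Acta Arith. 132 (2008)
  231–244, §3 Fact 2 (p. 234: conjugate subgroups give isomorphic quotients).
-/

noncomputable section

universe u

open CategoryTheory CategoryTheory.Limits Equiv

namespace Literature.AlgebraicGeometry.Motives

/-! ## Part A — the partitions of `S₄ ≅ PGL₂(3)` and `S₅ ≅ PGL₂(5)` into their maximal cyclic subgroups -/

namespace SymmetricGroupPartition

/-! ### §0 From finite power tables to the hypotheses of Theorem B (any group) -/

/-- Membership in a conjugate cyclic subgroup: `x ∈ ⟨c b c⁻¹⟩ ↔ c⁻¹ x c ∈ ⟨b⟩`. [folklore] -/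
private theorem mem_zpowers_conj_iff {G : Type*} [Group G] (b c x : G) :
    x ∈ Subgroup.zpowers (c * b * c⁻¹) ↔ c⁻¹ * x * c ∈ Subgroup.zpowers b := by
  simp only [Subgroup.mem_zpowers_iff]
  constructor
  · rintro ⟨k, rfl⟩
    exact ⟨k, by rw [conj_zpow]; group⟩
  · rintro ⟨k, hk⟩
    exact ⟨k, by rw [conj_zpow, hk]; group⟩

/-- The trivial conjugation `x ∈ H ↔ 1⁻¹ x 1 ∈ H`. [folklore] -/
private theorem mem_iff_one_conj_mem {G : Type*} [Group G] (H : Subgroup G) (x : G) :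
    x ∈ H ↔ (1 : G)⁻¹ * x * 1 ∈ H := by
  rw [inv_one, one_mul, mul_one]

/-- A covering by bounded powers of the generators covers by the cyclic subgroups. [folklore] -/
private theorem exists_mem_zpowers_of_exists_pow_eq {G ι : Type*} [Group G] (gen : ι → G) (ord : ι → ℕ)
    (h : ∀ x : G, ∃ i, ∃ n : Fin (ord i), gen i ^ (n : ℕ) = x) (x : G) :
    ∃ i, x ∈ Subgroup.zpowers (gen i) := by
  obtain ⟨i, n, hn⟩ := h x
  exact ⟨i, hn ▸ Subgroup.npow_mem_zpowers (gen i) n⟩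

/-- An element of `⟨g⟩` with `g ^ m = 1`, `0 < m`, is `g ^ a` for some `a < m`. [folklore] -/
private theorem exists_fin_pow_eq_of_mem_zpowers {G : Type*} [Group G] [Finite G] {g x : G} {m : ℕ}
    (hm : 0 < m) (hg : g ^ m = 1) (hx : x ∈ Subgroup.zpowers g) : ∃ a : Fin m, g ^ (a : ℕ) = x := by
  classical
  rw [mem_zpowers_iff_mem_range_orderOf] at hx
  obtain ⟨a, ha, rfl⟩ := Finset.mem_image.1 hx
  exact ⟨⟨a, lt_of_lt_of_le (Finset.mem_range.1 ha) (orderOf_le_of_pow_eq_one hm hg)⟩, rfl⟩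

/-- Pairwise trivial intersections from the bounded power tables. [folklore] -/
private theorem eq_one_of_mem_zpowers_of_mem_zpowers {G ι : Type*} [Group G] [Finite G] (gen : ι → G)
    (ord : ι → ℕ) (hord0 : ∀ i, 0 < ord i) (hord : ∀ i, gen i ^ ord i = 1)
    (h : ∀ i j, i ≠ j → ∀ a : Fin (ord i), ∀ b : Fin (ord j),
      gen i ^ (a : ℕ) = gen j ^ (b : ℕ) → gen i ^ (a : ℕ) = 1)
    {i j : ι} (hij : i ≠ j) {x : G} (hi : x ∈ Subgroup.zpowers (gen i))
    (hj : x ∈ Subgroup.zpowers (gen j)) : x = 1 := by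
  obtain ⟨a, rfl⟩ := exists_fin_pow_eq_of_mem_zpowers (hord0 i) (hord i) hi
  obtain ⟨b, hb⟩ := exists_fin_pow_eq_of_mem_zpowers (hord0 j) (hord j) hj
  exact h i j hij a b hb.symm

/-! ### §1 `S₄`: the `13 = 6 + 4 + 3` maximal cyclic subgroups (transpositions, `3`-cycles, `4`-cycles) form a
partition with three conjugacy classes; representatives `⟨(0 1)⟩`, `⟨(0 1)(1 2)⟩ = ⟨(0 1 2)⟩`,
`⟨(0 1)(1 2)(2 3)⟩ = ⟨(0 1 2 3)⟩` -/

/-- **The partition of `S₄ ≅ PGL₂(3)` into its maximal cyclic subgroups, machine-checked.**  Index the components by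
`Fin 3 ⊕ Fin 10`: `inl k` is the representative of class `k` (`k = 0, 1, 2`: the cyclic subgroups generated by
`(0 1)`, `(0 1 2) = (0 1)(1 2)`, `(0 1 2 3) = (0 1)(1 2)(2 3)`, of orders `2, 3, 4`), `inr j` the ten other components,
each a conjugate `c_j b_{k(j)} c_j⁻¹` of a representative (`5` further transpositions, `3` further `3`-cycles — one per
Sylow `3`-subgroup — and `2` further `4`-cycles).  Then: every element of `S₄` is a power `gen_i ^ n`, `n < |gen_i|`
(the `13` subgroups COVER `S₄`: `1 + 6·1 + 4·2 + 3·3 = 24`), two distinct components meet only in `1`, and the orders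
are `2, 3, 4` — all by `decide` ("`G` has `9` elements of order `2`, `8` elements of order `3` and `6` elements of
order `4`"; `S₄` is one of the partitionable groups of the Baer–Kegel–Suzuki classification).
[cite: GaronziDias2019, §1 (Baer–Kegel–Suzuki classification: "S_4 (the symmetric group of degree 4)") and §4 (element orders of S_4, "S_4 ≅ PGL_2(3)")]
[cite: KorchmarosLiaTimpanella2021, §10 ("equipped by a partition")] -/
theorem s4_pow_tables :
    let base : Fin 3 → Perm (Fin 4) := ![swap 0 1, swap 0 1 * swap 1 2, swap 0 1 * swap 1 2 * swap 2 3]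
    let cls : Fin 10 → Fin 3 := ![0, 0, 0, 0, 0, 1, 1, 1, 2, 2]
    let cj : Fin 10 → Perm (Fin 4) :=
      ![swap 1 2, swap 1 3, swap 0 2, swap 0 3, swap 0 2 * swap 1 3, swap 2 3, swap 1 3, swap 0 3, swap 1 2, swap 2 3]
    let ord : Fin 3 → ℕ := ![2, 3, 4]
    let gen : Fin 3 ⊕ Fin 10 → Perm (Fin 4) := Sum.elim base fun j ↦ cj j * base (cls j) * (cj j)⁻¹
    let ordι : Fin 3 ⊕ Fin 10 → ℕ := Sum.elim ord fun j ↦ ord (cls j)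
    (∀ i, gen i ^ ordι i = 1) ∧ (∀ x : Perm (Fin 4), ∃ i, ∃ n : Fin (ordι i), gen i ^ (n : ℕ) = x) ∧
      (∀ i j, i ≠ j → ∀ a : Fin (ordι i), ∀ b : Fin (ordι j),
        gen i ^ (a : ℕ) = gen j ^ (b : ℕ) → gen i ^ (a : ℕ) = 1) := by
  refine ⟨?_, ?_, ?_⟩
  · decide +kernel
  · decide +kernel
  · decide +kernel

/-- The class sizes of the `S₄` partition: `6` transposition subgroups, `4` Sylow `3`-subgroups, `3` cyclic subgroups
of order `4` (`#{i : cls i = k}` on the index set `Fin 3 ⊕ Fin 10`). [cite: GaronziDias2019, §4 ("9 elements of order 2, 8 elements of order 3 and 6 elements of order 4")] -/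
theorem s4_card_classes :
    let cls : Fin 10 → Fin 3 := ![0, 0, 0, 0, 0, 1, 1, 1, 2, 2]
    let clsι : Fin 3 ⊕ Fin 10 → Fin 3 := Sum.elim id cls
    (∀ k : Fin 3, Fintype.card {i // clsι i = k} = (![6, 4, 3] : Fin 3 → ℕ) k) := by
  decide +kernel

/-- The orders of the representatives: `|(0 1)| = 2`, `|(0 1 2)| = 3`, `|(0 1 2 3)| = 4`, as cardinalities of the
cyclic subgroups. [cite: GaronziDias2019, §4] -/
theorem s4_card_zpowers :
    Fintype.card (Subgroup.zpowers (swap (0 : Fin 4) 1)) = 2 ∧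
      Fintype.card (Subgroup.zpowers (swap (0 : Fin 4) 1 * swap 1 2)) = 3 ∧
        Fintype.card (Subgroup.zpowers (swap (0 : Fin 4) 1 * swap 1 2 * swap 2 3)) = 4 := by
  refine ⟨?_, ?_, ?_⟩
  · rw [Fintype.card_zpowers, orderOf_eq_prime_iff (p := 2)]
    decide
  · rw [Fintype.card_zpowers, orderOf_eq_prime_iff (p := 3)]
    decide
  · rw [Fintype.card_zpowers, orderOf_eq_iff (by norm_num)]
    decide

/-- `|S₄| = 24`. [folklore] -/
private theorem card_perm_fin_four : Fintype.card (Perm (Fin 4)) = 24 := by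
  rw [Fintype.card_perm, Fintype.card_fin]
  rfl

/-! ### §1′ `S₅ ≅ PGL₂(5)`: the `31 = 15 + 6 + 10` maximal cyclic subgroups (of orders `4`, `5`, `6`) form a partition
with three conjugacy classes; representatives `⟨(0 1)(1 2)(2 3)⟩ = ⟨(0 1 2 3)⟩`, `⟨(0 1)(1 2)(2 3)(3 4)⟩ = ⟨(0 1 2 3 4)⟩`,
`⟨(0 1)(1 2)(3 4)⟩ = ⟨(0 1 2)(3 4)⟩` -/

/-- **The partition of `S₅ ≅ PGL₂(5)` into its maximal cyclic subgroups, machine-checked** ("`Sym_5 ≅ PGL(2, 5)` is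
equipped with a partition whose components form three conjugacy classes of lengths `15, 6, 10`, namely those
consisting of all cyclic subgroups of order `4, 5` and `6`, respectively").  Index the components by `Fin 3 ⊕ Fin 28`:
`inl k` is the representative of class `k` (generated by `(0 1 2 3) = (0 1)(1 2)(2 3)`, `(0 1 2 3 4) = (0 1)(1 2)(2 3)(3 4)`,
`(0 1 2)(3 4) = (0 1)(1 2)(3 4)`, of orders `4, 5, 6`), `inr j` the `14 + 5 + 9` other components, each a conjugate
`c_j b_{k(j)} c_j⁻¹` of a representative.  Then every element of `S₅` is a power `gen_i ^ n`, `n < |gen_i|` (the `31`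
subgroups COVER `S₅`: `1 + 15·3 + 6·4 + 10·5 = 120`), two distinct components meet only in `1`, and the orders are
`4, 5, 6` — all by `decide` ("The group `G` has `25` elements of order `2`, `20` elements of order `3`, `30` elements
of order `4`, `24` elements of order `5` and `20` elements of order `6`").
[cite: KorchmarosLiaTimpanella2021, §10 (the partition of Sym_5 ≅ PGL(2,5), classes of lengths 15, 6, 10)]
[cite: GaronziDias2019, §1 (Baer–Kegel–Suzuki: PGL_2(p^m), p^m ≥ 5) and §7 ("ρ(PGL_2(5))", element orders of S_5)] -/
theorem s5_pow_tables :
    let base : Fin 3 → Perm (Fin 5) :=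
      ![swap 0 1 * swap 1 2 * swap 2 3, swap 0 1 * swap 1 2 * swap 2 3 * swap 3 4, swap 0 1 * swap 1 2 * swap 3 4]
    let cls : Fin 28 → Fin 3 :=
      ![0, 0, 0, 0, 0, 0, 0, 0, 0, 0, 0, 0, 0, 0, 1, 1, 1, 1, 1, 2, 2, 2, 2, 2, 2, 2, 2, 2]
    let cj : Fin 28 → Perm (Fin 5) :=
      ![swap 0 1, swap 0 3, swap 0 4, swap 1 4, swap 2 4, swap 3 4, swap 0 1 * swap 0 4, swap 0 1 * swap 1 4,
        swap 0 1 * swap 2 4, swap 0 1 * swap 3 4, swap 0 3 * swap 0 4, swap 0 3 * swap 1 4, swap 0 3 * swap 2 4,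
        swap 0 3 * swap 3 4,
        swap 0 1, swap 0 2, swap 0 3, swap 0 4, swap 1 4,
        swap 0 3, swap 0 4, swap 1 3, swap 1 4, swap 2 3, swap 2 4, swap 0 3 * swap 1 4, swap 0 3 * swap 2 4,
        swap 1 3 * swap 2 4]
    let ord : Fin 3 → ℕ := ![4, 5, 6]
    let gen : Fin 3 ⊕ Fin 28 → Perm (Fin 5) := Sum.elim base fun j ↦ cj j * base (cls j) * (cj j)⁻¹
    let ordι : Fin 3 ⊕ Fin 28 → ℕ := Sum.elim ord fun j ↦ ord (cls j)
    (∀ i, gen i ^ ordι i = 1) ∧ (∀ x : Perm (Fin 5), ∃ i, ∃ n : Fin (ordι i), gen i ^ (n : ℕ) = x) ∧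
      (∀ i j, i ≠ j → ∀ a : Fin (ordι i), ∀ b : Fin (ordι j),
        gen i ^ (a : ℕ) = gen j ^ (b : ℕ) → gen i ^ (a : ℕ) = 1) := by
  refine ⟨?_, ?_, ?_⟩
  · decide +kernel
  · decide +kernel
  · decide +kernel

/-- The class sizes of the `S₅` partition: `15` cyclic subgroups of order `4`, `6` Sylow `5`-subgroups, `10` cyclic
subgroups of order `6` ("three conjugacy classes of lengths `15, 6, 10`"). [cite: KorchmarosLiaTimpanella2021, §10] -/
theorem s5_card_classes :
    let cls : Fin 28 → Fin 3 :=
      ![0, 0, 0, 0, 0, 0, 0, 0, 0, 0, 0, 0, 0, 0, 1, 1, 1, 1, 1, 2, 2, 2, 2, 2, 2, 2, 2, 2]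
    let clsι : Fin 3 ⊕ Fin 28 → Fin 3 := Sum.elim id cls
    (∀ k : Fin 3, Fintype.card {i // clsι i = k} = (![15, 6, 10] : Fin 3 → ℕ) k) := by
  decide +kernel

/-- The orders of the representatives: `|(0 1 2 3)| = 4`, `|(0 1 2 3 4)| = 5`, `|(0 1 2)(3 4)| = 6`, as cardinalities of
the cyclic subgroups. [cite: KorchmarosLiaTimpanella2021, §10 ("cyclic subgroups of order 4, 5 and 6")] -/
theorem s5_card_zpowers :
    Fintype.card (Subgroup.zpowers (swap (0 : Fin 5) 1 * swap 1 2 * swap 2 3)) = 4 ∧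
      Fintype.card (Subgroup.zpowers (swap (0 : Fin 5) 1 * swap 1 2 * swap 2 3 * swap 3 4)) = 5 ∧
        Fintype.card (Subgroup.zpowers (swap (0 : Fin 5) 1 * swap 1 2 * swap 3 4)) = 6 := by
  refine ⟨?_, ?_, ?_⟩
  · rw [Fintype.card_zpowers, orderOf_eq_iff (by norm_num)]
    decide
  · haveI : Fact (Nat.Prime 5) := ⟨by norm_num⟩
    rw [Fintype.card_zpowers, orderOf_eq_prime_iff (p := 5)]
    decide
  · rw [Fintype.card_zpowers, orderOf_eq_iff (by norm_num)]
    decide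

/-- `|S₅| = 120`. [folklore] -/
private theorem card_perm_fin_five : Fintype.card (Perm (Fin 5)) = 120 := by
  rw [Fintype.card_perm, Fintype.card_fin]
  rfl

end SymmetricGroupPartition

/-! ## Part B — the Kani–Rosen relations of `S₄` and `S₅` on the algebraic carrier -/

namespace AbelianVariety

variable {K : Type u} [Field K]

/-! ### §2 `S₄`: `B_{(01)} × B_{(012)} × B_{(0123)} ∼ X × B_{S₄}²` -/

section SymFour

open SymmetricGroupPartition

variable {X : AbelianVariety K} (ρ : Perm (Fin 4) →* End X) {N₂ N₃ N₄ NG : X ⟶ X}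

/-- **Kani–Rosen Theorem B for `S₄` equipped by the partition into its `13` maximal cyclic subgroups — the Hom counts
(any field)**: with `N₂, N₃, N₄` the norm endomorphisms of `⟨(0 1)⟩`, `⟨(0 1 2)⟩`, `⟨(0 1 2 3)⟩` and `N_G = Σ_g ρ(g)`,
for every `B`: **`rk Hom(B_{C₂}, B) + rk Hom(B_{C₃}, B) + rk Hom(B_{C₄}, B) = rk Hom(X, B) + 2 · rk Hom(B_{S₄}, B)`**
(`B_H = ε_H(X) = Im N_H`).  Theorem B's counts `Σ_i |H_i| rk Hom(B_{H_i}, B) = (t − 1) rk Hom(X, B) + |G| rk Hom(B_G, B)`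
with `t = 13`, `|G| = 24`, the components sorted into the three classes (`6·2 = 4·3 = 3·4 = 12`, conjugate
components contribute equally) and divided by `12`. [cite: KaniRosen1989, Thm. B] [cite: KorchmarosLiaTimpanella2021, §10 Thm. 10.1 (32)]
[cite: GaronziDias2019, §1 and §4 (S_4 ≅ PGL_2(3) is partitionable)] -/
theorem finrank_hom_symFour (hN₂ : End.of N₂ = ∑ h : Subgroup.zpowers (swap (0 : Fin 4) 1), ρ h)
    (hN₃ : End.of N₃ = ∑ h : Subgroup.zpowers (swap (0 : Fin 4) 1 * swap 1 2), ρ h)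
    (hN₄ : End.of N₄ = ∑ h : Subgroup.zpowers (swap (0 : Fin 4) 1 * swap 1 2 * swap 2 3), ρ h)
    (hNG : End.of NG = ∑ g, ρ g) (B : AbelianVariety K) :
    Module.finrank ℤ (image N₂ ⟶ B) + Module.finrank ℤ (image N₃ ⟶ B) + Module.finrank ℤ (image N₄ ⟶ B) =
      Module.finrank ℤ (X ⟶ B) + 2 * Module.finrank ℤ (image NG ⟶ B) := by
  classical
  obtain ⟨hord, hcov, hdis⟩ := s4_pow_tables
  have hcls := s4_card_classes
  obtain ⟨c2, c3, c4⟩ := s4_card_zpowers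
  -- the partition data on the index set `Fin 3 ⊕ Fin 10`
  let base : Fin 3 → Perm (Fin 4) := ![swap 0 1, swap 0 1 * swap 1 2, swap 0 1 * swap 1 2 * swap 2 3]
  let cls : Fin 10 → Fin 3 := ![0, 0, 0, 0, 0, 1, 1, 1, 2, 2]
  let cj : Fin 10 → Perm (Fin 4) :=
    ![swap 1 2, swap 1 3, swap 0 2, swap 0 3, swap 0 2 * swap 1 3, swap 2 3, swap 1 3, swap 0 3, swap 1 2, swap 2 3]
  let ord : Fin 3 → ℕ := ![2, 3, 4]
  let gen : Fin 3 ⊕ Fin 10 → Perm (Fin 4) := Sum.elim base fun j ↦ cj j * base (cls j) * (cj j)⁻¹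
  let ordι : Fin 3 ⊕ Fin 10 → ℕ := Sum.elim ord fun j ↦ ord (cls j)
  let H : Fin 3 ⊕ Fin 10 → Subgroup (Perm (Fin 4)) := fun i ↦ Subgroup.zpowers (gen i)
  let clsι : Fin 3 ⊕ Fin 10 → Fin 3 := Sum.elim id cls
  let rep : Fin 3 → Fin 3 ⊕ Fin 10 := Sum.inl
  let g : Fin 3 ⊕ Fin 10 → Perm (Fin 4) := Sum.elim (fun _ ↦ 1) cj
  let Nf : Fin 3 ⊕ Fin 10 → (X ⟶ X) := Sum.elim ![N₂, N₃, N₄] fun j ↦ End.asHom (∑ h : H (Sum.inr j), ρ h)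
  have hord0 : ∀ i, 0 < ordι i := by decide
  have hcover : ∀ x : Perm (Fin 4), ∃ i, x ∈ H i := exists_mem_zpowers_of_exists_pow_eq gen ordι hcov
  have hdisj : ∀ i j, i ≠ j → ∀ x : Perm (Fin 4), x ∈ H i → x ∈ H j → x = 1 :=
    fun i j hij x hi hj ↦ eq_one_of_mem_zpowers_of_mem_zpowers gen ordι hord0 hord hdis hij hi hj
  have hconj : ∀ i x, x ∈ H i ↔ (g i)⁻¹ * x * g i ∈ H (rep (clsι i)) := by
    rintro (k | j) x
    · exact mem_iff_one_conj_mem _ x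
    · exact mem_zpowers_conj_iff _ _ x
  have hNf : ∀ i, End.of (Nf i) = ∑ h : H i, ρ h := by
    rintro (k | j)
    · fin_cases k
      · exact hN₂
      · exact hN₃
      · exact hN₄
    · rfl
  have key := sum_card_fiber_mul_finrank_hom_image_eq_of_partition ρ H clsι rep g hcover hdisj hNf hNG hconj B
  rw [Fin.sum_univ_three, hcls 0, hcls 1, hcls 2, Fintype.card_sum, Fintype.card_fin, Fintype.card_fin,
    card_perm_fin_four] at key
  have e2 : Fintype.card (H (rep 0)) = 2 := c2
  have e3 : Fintype.card (H (rep 1)) = 3 := c3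
  have e4 : Fintype.card (H (rep 2)) = 4 := c4
  rw [e2, e3, e4] at key
  have r2 : Module.finrank ℤ (image (Nf (rep 0)) ⟶ B) = Module.finrank ℤ (image N₂ ⟶ B) := rfl
  have r3 : Module.finrank ℤ (image (Nf (rep 1)) ⟶ B) = Module.finrank ℤ (image N₃ ⟶ B) := rfl
  have r4 : Module.finrank ℤ (image (Nf (rep 2)) ⟶ B) = Module.finrank ℤ (image N₄ ⟶ B) := rfl
  rw [r2, r3, r4] at key
  simp only [Matrix.cons_val_zero, Matrix.cons_val_one, Matrix.cons_val] at key
  omega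

variable [PerfectField K]

/-- **The Kani–Rosen relation of `S₄`: `X × B_{S₄}² ∼ B_{C₂} × B_{C₃} × B_{C₄}`** (perfect field) — for a Jacobian
with `S₄`-action, `J_C × J²_{C/S₄} ∼ J_{C/⟨(01)⟩} × J_{C/⟨(012)⟩} × J_{C/⟨(0123)⟩}`: Theorem B
"`J^{t−1}_C × J^{|G|}_{C/G} ∼ J^{h_1}_{C/H_1} × ⋯ × J^{h_t}_{C/H_t}`" for the partition of `S₄` into its `13` maximal
cyclic subgroups (`X^{12} × B_G^{24} ∼ B_{C₂}^{12} × B_{C₃}^{12} × B_{C₄}^{12}`), conjugate components identified and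
"up to isogeny one can cancel factors". [cite: KaniRosen1989, Thm. B] [cite: KorchmarosLiaTimpanella2021, §10 Thm. 10.1 (32)–(33)]
[cite: GaronziDias2019, §1 and §4] -/
theorem isIsogenous_symFour (hN₂ : End.of N₂ = ∑ h : Subgroup.zpowers (swap (0 : Fin 4) 1), ρ h)
    (hN₃ : End.of N₃ = ∑ h : Subgroup.zpowers (swap (0 : Fin 4) 1 * swap 1 2), ρ h)
    (hN₄ : End.of N₄ = ∑ h : Subgroup.zpowers (swap (0 : Fin 4) 1 * swap 1 2 * swap 2 3), ρ h)
    (hNG : End.of NG = ∑ g, ρ g) :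
    IsIsogenous (X ⊞ (image NG ⊞ image NG)) (image N₂ ⊞ (image N₃ ⊞ image N₄)) := by
  refine isIsogenous_iff_forall_finrank_hom_eq'.2 fun B ↦ ?_
  rw [finrank_hom_biprod, finrank_hom_biprod, finrank_hom_biprod, finrank_hom_biprod]
  have h := finrank_hom_symFour ρ hN₂ hN₃ hN₄ hNG B
  omega

/-- **Dimensions in the `S₄` relation: `dim X + 2 dim B_{S₄} = dim B_{C₂} + dim B_{C₃} + dim B_{C₄}`** (for Jacobians
the genus formula `g + 2 g_{S₄} = g_{C₂} + g_{C₃} + g_{C₄}`; perfect field). [cite: KaniRosen1989, Thm. B]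
[cite: KorchmarosLiaTimpanella2021, §10 Thm. 10.1] -/
theorem dim_symFour (hN₂ : End.of N₂ = ∑ h : Subgroup.zpowers (swap (0 : Fin 4) 1), ρ h)
    (hN₃ : End.of N₃ = ∑ h : Subgroup.zpowers (swap (0 : Fin 4) 1 * swap 1 2), ρ h)
    (hN₄ : End.of N₄ = ∑ h : Subgroup.zpowers (swap (0 : Fin 4) 1 * swap 1 2 * swap 2 3), ρ h)
    (hNG : End.of NG = ∑ g, ρ g) :
    X.dim + 2 * (image NG).dim = (image N₂).dim + (image N₃).dim + (image N₄).dim := by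
  have h := (isIsogenous_symFour ρ hN₂ hN₃ hN₄ hNG).dim_eq
  rw [dim_biprod, dim_biprod, dim_biprod, dim_biprod] at h
  omega

/-- **`B_{S₄} = 0` (`X/S₄` "rational"): `X ∼ B_{C₂} × B_{C₃} × B_{C₄}`** (perfect field).
[cite: KaniRosen1989, Thm. B] [cite: KorchmarosLiaTimpanella2021, §10 (33) ("since V/G is rational")] -/
theorem isIsogenous_symFour_of_dim_eq_zero (hN₂ : End.of N₂ = ∑ h : Subgroup.zpowers (swap (0 : Fin 4) 1), ρ h)
    (hN₃ : End.of N₃ = ∑ h : Subgroup.zpowers (swap (0 : Fin 4) 1 * swap 1 2), ρ h)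
    (hN₄ : End.of N₄ = ∑ h : Subgroup.zpowers (swap (0 : Fin 4) 1 * swap 1 2 * swap 2 3), ρ h)
    (hNG : End.of NG = ∑ g, ρ g) (h0 : (image NG).dim = 0) :
    IsIsogenous X (image N₂ ⊞ (image N₃ ⊞ image N₄)) := by
  refine isIsogenous_iff_forall_finrank_hom_eq'.2 fun B ↦ ?_
  rw [finrank_hom_biprod, finrank_hom_biprod]
  have h := finrank_hom_symFour ρ hN₂ hN₃ hN₄ hNG B
  haveI : Subsingleton (image NG ⟶ B) := ⟨fun f f' ↦ by
    rw [hom_eq_zero_of_dim_eq_zero_left (image NG) h0 f, hom_eq_zero_of_dim_eq_zero_left (image NG) h0 f']⟩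
  have hz : Module.finrank ℤ (image NG ⟶ B) = 0 := Module.finrank_zero_of_subsingleton
  omega

end SymFour

/-! ### §3 `S₅ ≅ PGL₂(5)`: `B_{C₄}² × B_{C₅} × B_{C₆}² ∼ X × B_{S₅}⁴` (Korchmáros–Lia–Timpanella (33)) -/

section SymFive

open SymmetricGroupPartition

variable {X : AbelianVariety K} (ρ : Perm (Fin 5) →* End X) {N₄ N₅ N₆ NG : X ⟶ X}

/-- **Kani–Rosen Theorem B for `S₅ ≅ PGL₂(5)` equipped by the partition into its `31` maximal cyclic subgroups — the
Hom counts (any field)**: with `N₄, N₅, N₆` the norm endomorphisms of `⟨(0 1 2 3)⟩`, `⟨(0 1 2 3 4)⟩`, `⟨(0 1 2)(3 4)⟩` and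
`N_G = Σ_g ρ(g)`, for every `B`:
**`2 · rk Hom(B_{C₄}, B) + rk Hom(B_{C₅}, B) + 2 · rk Hom(B_{C₆}, B) = rk Hom(X, B) + 4 · rk Hom(B_{S₅}, B)`** —
Theorem B's counts with `t = 31`, `|G| = 120`, classes `15·4 = 60`, `6·5 = 30`, `10·6 = 60`, divided by `30`
("(33) `J^{30}_V ∼ J^{60}_{V/C4} × J^{30}_{V/C5} × J^{60}_{V/C6}`"). [cite: KorchmarosLiaTimpanella2021, §10 Thm. 10.1 (32)–(33)]
[cite: KaniRosen1989, Thm. B] [cite: GaronziDias2019, §1 and §7 (PGL_2(5) ≅ S_5)] -/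
theorem finrank_hom_symFive (hN₄ : End.of N₄ = ∑ h : Subgroup.zpowers (swap (0 : Fin 5) 1 * swap 1 2 * swap 2 3), ρ h)
    (hN₅ : End.of N₅ = ∑ h : Subgroup.zpowers (swap (0 : Fin 5) 1 * swap 1 2 * swap 2 3 * swap 3 4), ρ h)
    (hN₆ : End.of N₆ = ∑ h : Subgroup.zpowers (swap (0 : Fin 5) 1 * swap 1 2 * swap 3 4), ρ h)
    (hNG : End.of NG = ∑ g, ρ g) (B : AbelianVariety K) :
    2 * Module.finrank ℤ (image N₄ ⟶ B) + Module.finrank ℤ (image N₅ ⟶ B) +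
        2 * Module.finrank ℤ (image N₆ ⟶ B) =
      Module.finrank ℤ (X ⟶ B) + 4 * Module.finrank ℤ (image NG ⟶ B) := by
  classical
  obtain ⟨hord, hcov, hdis⟩ := s5_pow_tables
  have hcls := s5_card_classes
  obtain ⟨c4, c5, c6⟩ := s5_card_zpowers
  -- the partition data on the index set `Fin 3 ⊕ Fin 28`
  let base : Fin 3 → Perm (Fin 5) :=
    ![swap 0 1 * swap 1 2 * swap 2 3, swap 0 1 * swap 1 2 * swap 2 3 * swap 3 4, swap 0 1 * swap 1 2 * swap 3 4]
  let cls : Fin 28 → Fin 3 :=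
    ![0, 0, 0, 0, 0, 0, 0, 0, 0, 0, 0, 0, 0, 0, 1, 1, 1, 1, 1, 2, 2, 2, 2, 2, 2, 2, 2, 2]
  let cj : Fin 28 → Perm (Fin 5) :=
    ![swap 0 1, swap 0 3, swap 0 4, swap 1 4, swap 2 4, swap 3 4, swap 0 1 * swap 0 4, swap 0 1 * swap 1 4,
      swap 0 1 * swap 2 4, swap 0 1 * swap 3 4, swap 0 3 * swap 0 4, swap 0 3 * swap 1 4, swap 0 3 * swap 2 4,
      swap 0 3 * swap 3 4,
      swap 0 1, swap 0 2, swap 0 3, swap 0 4, swap 1 4,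
      swap 0 3, swap 0 4, swap 1 3, swap 1 4, swap 2 3, swap 2 4, swap 0 3 * swap 1 4, swap 0 3 * swap 2 4,
      swap 1 3 * swap 2 4]
  let ord : Fin 3 → ℕ := ![4, 5, 6]
  let gen : Fin 3 ⊕ Fin 28 → Perm (Fin 5) := Sum.elim base fun j ↦ cj j * base (cls j) * (cj j)⁻¹
  let ordι : Fin 3 ⊕ Fin 28 → ℕ := Sum.elim ord fun j ↦ ord (cls j)
  let H : Fin 3 ⊕ Fin 28 → Subgroup (Perm (Fin 5)) := fun i ↦ Subgroup.zpowers (gen i)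
  let clsι : Fin 3 ⊕ Fin 28 → Fin 3 := Sum.elim id cls
  let rep : Fin 3 → Fin 3 ⊕ Fin 28 := Sum.inl
  let g : Fin 3 ⊕ Fin 28 → Perm (Fin 5) := Sum.elim (fun _ ↦ 1) cj
  let Nf : Fin 3 ⊕ Fin 28 → (X ⟶ X) := Sum.elim ![N₄, N₅, N₆] fun j ↦ End.asHom (∑ h : H (Sum.inr j), ρ h)
  have hord0 : ∀ i, 0 < ordι i := by decide
  have hcover : ∀ x : Perm (Fin 5), ∃ i, x ∈ H i := exists_mem_zpowers_of_exists_pow_eq gen ordι hcov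
  have hdisj : ∀ i j, i ≠ j → ∀ x : Perm (Fin 5), x ∈ H i → x ∈ H j → x = 1 :=
    fun i j hij x hi hj ↦ eq_one_of_mem_zpowers_of_mem_zpowers gen ordι hord0 hord hdis hij hi hj
  have hconj : ∀ i x, x ∈ H i ↔ (g i)⁻¹ * x * g i ∈ H (rep (clsι i)) := by
    rintro (k | j) x
    · exact mem_iff_one_conj_mem _ x
    · exact mem_zpowers_conj_iff _ _ x
  have hNf : ∀ i, End.of (Nf i) = ∑ h : H i, ρ h := by
    rintro (k | j)
    · fin_cases k
      · exact hN₄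
      · exact hN₅
      · exact hN₆
    · rfl
  have key := sum_card_fiber_mul_finrank_hom_image_eq_of_partition ρ H clsι rep g hcover hdisj hNf hNG hconj B
  rw [Fin.sum_univ_three, hcls 0, hcls 1, hcls 2, Fintype.card_sum, Fintype.card_fin, Fintype.card_fin,
    card_perm_fin_five] at key
  have e4 : Fintype.card (H (rep 0)) = 4 := c4
  have e5 : Fintype.card (H (rep 1)) = 5 := c5
  have e6 : Fintype.card (H (rep 2)) = 6 := c6
  rw [e4, e5, e6] at key
  have r4 : Module.finrank ℤ (image (Nf (rep 0)) ⟶ B) = Module.finrank ℤ (image N₄ ⟶ B) := rfl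
  have r5 : Module.finrank ℤ (image (Nf (rep 1)) ⟶ B) = Module.finrank ℤ (image N₅ ⟶ B) := rfl
  have r6 : Module.finrank ℤ (image (Nf (rep 2)) ⟶ B) = Module.finrank ℤ (image N₆ ⟶ B) := rfl
  rw [r4, r5, r6] at key
  simp only [Matrix.cons_val_zero, Matrix.cons_val_one, Matrix.cons_val] at key
  omega

variable [PerfectField K]

/-- **The Kani–Rosen relation of `S₅ ≅ PGL₂(5)`: `X × B_{S₅}⁴ ∼ B_{C₄}² × B_{C₅} × B_{C₆}²`** (perfect field) —
Korchmáros–Lia–Timpanella's (32)/(33) "`J^{30}_V ∼ J^{60}_{V/C4} × J^{30}_{V/C5} × J^{60}_{V/C6}`" (there with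
`J_{V/G} = 0`), i.e. Theorem B for the `31`-component partition (`X^{30} × B_G^{120} ∼ B_{C₄}^{60} × B_{C₅}^{30} ×
B_{C₆}^{60}`) with the exponents divided by `30`. [cite: KorchmarosLiaTimpanella2021, §10 Thm. 10.1 (32)–(33)]
[cite: KaniRosen1989, Thm. B] [cite: GaronziDias2019, §1 and §7] -/
theorem isIsogenous_symFive (hN₄ : End.of N₄ = ∑ h : Subgroup.zpowers (swap (0 : Fin 5) 1 * swap 1 2 * swap 2 3), ρ h)
    (hN₅ : End.of N₅ = ∑ h : Subgroup.zpowers (swap (0 : Fin 5) 1 * swap 1 2 * swap 2 3 * swap 3 4), ρ h)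
    (hN₆ : End.of N₆ = ∑ h : Subgroup.zpowers (swap (0 : Fin 5) 1 * swap 1 2 * swap 3 4), ρ h)
    (hNG : End.of NG = ∑ g, ρ g) :
    IsIsogenous (X ⊞ ⨁ fun _ : Fin 4 ↦ image NG)
      ((image N₄ ⊞ image N₄) ⊞ (image N₅ ⊞ (image N₆ ⊞ image N₆))) := by
  classical
  refine isIsogenous_iff_forall_finrank_hom_eq'.2 fun B ↦ ?_
  rw [finrank_hom_biprod, finrank_hom_biproduct_const, finrank_hom_biprod, finrank_hom_biprod, finrank_hom_biprod,
    finrank_hom_biprod, Fintype.card_fin]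
  have h := finrank_hom_symFive ρ hN₄ hN₅ hN₆ hNG B
  omega

/-- **Dimensions in the `S₅` relation: `dim X + 4 dim B_{S₅} = 2 dim B_{C₄} + dim B_{C₅} + 2 dim B_{C₆}`** (for
Jacobians `g + 4 g_{S₅} = 2 g_{C₄} + g_{C₅} + 2 g_{C₆}`; perfect field). [cite: KorchmarosLiaTimpanella2021, §10 Thm. 10.1 (32)–(33)]
[cite: KaniRosen1989, Thm. B] -/
theorem dim_symFive (hN₄ : End.of N₄ = ∑ h : Subgroup.zpowers (swap (0 : Fin 5) 1 * swap 1 2 * swap 2 3), ρ h)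
    (hN₅ : End.of N₅ = ∑ h : Subgroup.zpowers (swap (0 : Fin 5) 1 * swap 1 2 * swap 2 3 * swap 3 4), ρ h)
    (hN₆ : End.of N₆ = ∑ h : Subgroup.zpowers (swap (0 : Fin 5) 1 * swap 1 2 * swap 3 4), ρ h)
    (hNG : End.of NG = ∑ g, ρ g) :
    X.dim + 4 * (image NG).dim = 2 * (image N₄).dim + (image N₅).dim + 2 * (image N₆).dim := by
  have h := (isIsogenous_symFive ρ hN₄ hN₅ hN₆ hNG).dim_eq
  rw [dim_biprod, dim_biproduct_const, Fintype.card_fin, dim_biprod, dim_biprod, dim_biprod, dim_biprod] at h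
  omega

/-- **`B_{S₅} = 0`: `X ∼ B_{C₄}² × B_{C₅} × B_{C₆}²` — "since `V/G` is rational, Theorem 10.1 reads
`J^{30}_V ∼ J^{60}_{V/C4} × J^{30}_{V/C5} × J^{60}_{V/C6}`", whence `J_V ∼ J²_{V/C4} × J_{V/C5} × J²_{V/C6}`**
(perfect field). [cite: KorchmarosLiaTimpanella2021, §10 Thm. 10.1 and (33)] [cite: KaniRosen1989, Thm. B] -/
theorem isIsogenous_symFive_of_dim_eq_zero
    (hN₄ : End.of N₄ = ∑ h : Subgroup.zpowers (swap (0 : Fin 5) 1 * swap 1 2 * swap 2 3), ρ h)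
    (hN₅ : End.of N₅ = ∑ h : Subgroup.zpowers (swap (0 : Fin 5) 1 * swap 1 2 * swap 2 3 * swap 3 4), ρ h)
    (hN₆ : End.of N₆ = ∑ h : Subgroup.zpowers (swap (0 : Fin 5) 1 * swap 1 2 * swap 3 4), ρ h)
    (hNG : End.of NG = ∑ g, ρ g) (h0 : (image NG).dim = 0) :
    IsIsogenous X ((image N₄ ⊞ image N₄) ⊞ (image N₅ ⊞ (image N₆ ⊞ image N₆))) := by
  refine isIsogenous_iff_forall_finrank_hom_eq'.2 fun B ↦ ?_
  rw [finrank_hom_biprod, finrank_hom_biprod, finrank_hom_biprod, finrank_hom_biprod]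
  have h := finrank_hom_symFive ρ hN₄ hN₅ hN₆ hNG B
  haveI : Subsingleton (image NG ⟶ B) := ⟨fun f f' ↦ by
    rw [hom_eq_zero_of_dim_eq_zero_left (image NG) h0 f, hom_eq_zero_of_dim_eq_zero_left (image NG) h0 f']⟩
  have hz : Module.finrank ℤ (image NG ⟶ B) = 0 := Module.finrank_zero_of_subsingleton
  omega

end SymFive

end AbelianVariety

/-!
# Part II (v2, appended 2026-08-27, same seat, row g24-#3): the alternating group `A₅ ≅ PSL₂(4) ≅ PSL₂(5)` EQUIPPED BY
# THE PARTITION into its `31 = 15 + 10 + 6` subgroups of prime order (machine-checked): `X × B_{A₅}² ∼ B_{C₂} × B_{C₃} ×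
# B_{C₅}` — ALGEBRAIC carrier

Continuation of Part I = §§0–3 above (add-only; Part I unchanged except for the one new `import
Mathlib.GroupTheory.SpecificGroups.Alternating`).  Every non-identity element of `A₅` has prime order `2`, `3` or `5`,
so the subgroups of prime order — the `15` subgroups generated by the double transpositions, the `10` Sylow
`3`-subgroups and the `6` Sylow `5`-subgroups — cover `A₅` (`15·1 + 10·2 + 6·4 = 59`) and meet pairwise trivially:
`A₅ ≅ PSL₂(4) ≅ PSL₂(5)` is "equipped by a partition" (item "`PSL_2(p^m)` with `p^m ≥ 4`" of the Baer–Kegel–Suzuki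
list), with three conjugacy classes of lengths `15, 10, 6` and `15·2 = 10·3 = 6·5 = 30 = t − 1 = |G|/2`, so that
Theorem B's `X^{30} × B_G^{60} ∼ B_{C₂}^{30} × B_{C₃}^{30} × B_{C₅}^{30}` divides by `30`.  The carrier is Mathlib's
subgroup type `↥(alternatingGroup (Fin 5))`; the tables are written with EVEN permutations (products of two
transpositions) so that representatives and conjugating elements lie in `A₅`; the `decide` obligations are stated on
`Equiv.Perm (Fin 5)` (cover: every EVEN permutation is a power of a generator) and lifted to the subgroup type inside
the proof.  Everything is PROVED; no definition, no named fact (net Literature debt 0).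

## Sources, verbatim (Part II)

[KorchmarosLiaTimpanella2021] §10 p. 27 (Theorem 10.1 = Kani–Rosen Thm. B for a group "equipped by a partition", (32))
as quoted in Part I.  [GaronziDias2019] §1 p0003: "Baer, Kegel and Suzuki proved that a group `G` is partitionable if and
only if it is isomorphic to one of: `S_4` […], `PSL_2(p^m)` with `p^m ≥ 4`, `PGL_2(p^m)` with `p^m ≥ 5` and `p` odd, […]";
§7 p0011 (the subgroups of `PSL_2(q)`): "`A_4`, `S_4` or `A_5` for some values of `q`"; §7 p0012 ("We will think of
`PGL_2(5)` as of the symmetric group `S_5`. The group `G` has `25` elements of order `2`, `20` elements of order `3`, `30`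
elements of order `4`, `24` elements of order `5` and `20` elements of order `6`. The maximal subgroups of `G` are of one
of the following types: `A_5` (alternating group of degree `5`), […]").

## What is proved (Part II)

* §1″ (namespace `…SymmetricGroupPartition`): **`a5_pow_tables`** (by `decide`: orders `2, 3, 5` of the `31` generators
  `c_j b_k c_j⁻¹`, all generators and conjugators EVEN, every even permutation of `Fin 5` is a power `gen_i ^ n` with
  `n < |gen_i|`, two distinct components share only `1`), `a5_card_classes` (`15, 10, 6`), `a5_card_zpowers` (orders
  `2, 3, 5` of the representatives `(0 1)(2 3)`, `(0 1 2)`, `(0 1 2 3 4)` in `↥(alternatingGroup (Fin 5))`),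
  `card_alternatingGroup_fin_five` (`|A₅| = 60`).
* §4 (namespace `…AbelianVariety`): **`finrank_hom_altFive`** (any field: `rk Hom(B_{C₂}, B) + rk Hom(B_{C₃}, B) +
  rk Hom(B_{C₅}, B) = rk Hom(X, B) + 2 rk Hom(B_{A₅}, B)`), **`isIsogenous_altFive`** (perfect field: `X × B_{A₅}² ∼
  B_{C₂} × B_{C₃} × B_{C₅}`), `dim_altFive` (`dim X + 2 dim B_{A₅} = dim B_{C₂} + dim B_{C₃} + dim B_{C₅}`),
  `isIsogenous_altFive_of_dim_eq_zero` (`B_{A₅} = 0 ⟹ X ∼ B_{C₂} × B_{C₃} × B_{C₅}`).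
-/

namespace SymmetricGroupPartition

/-! ### §1″ `A₅`: the `31 = 15 + 10 + 6` subgroups of prime order (double transpositions, `3`-cycles, `5`-cycles) form
a partition with three conjugacy classes; representatives `⟨(0 1)(2 3)⟩`, `⟨(0 1)(1 2)⟩ = ⟨(0 1 2)⟩`,
`⟨(0 1)(1 2)(2 3)(3 4)⟩ = ⟨(0 1 2 3 4)⟩`, EVEN conjugators -/

/-- **The partition of `A₅ ≅ PSL₂(5)` into its subgroups of prime order, machine-checked** — stated on
`Equiv.Perm (Fin 5)`: with the representatives `b = (0 1)(2 3), (0 1 2), (0 1 2 3 4)` (orders `2, 3, 5`) and `28` EVEN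
conjugating elements `c_j` (products of two transpositions), the `31` generators `gen = b_k` resp. `c_j b_{k(j)} c_j⁻¹`
satisfy: `gen_i ^ |gen_i| = 1`; every generator and every conjugator is even; every EVEN permutation is a power
`gen_i ^ n`, `n < |gen_i|` (the `31` cyclic subgroups cover `A₅`: `1 + 15·1 + 10·2 + 6·4 = 60`); two distinct components
share only `1` — all by `decide`. [cite: GaronziDias2019, §1 (Baer–Kegel–Suzuki: "PSL_2(p^m) with p^m ≥ 4") and §7 (A_5 ≤ S_5 = PGL_2(5), element orders)]
[cite: KorchmarosLiaTimpanella2021, §10 ("equipped by a partition")] -/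
theorem a5_pow_tables :
    let base : Fin 3 → Perm (Fin 5) :=
      ![swap 0 1 * swap 2 3, swap 0 1 * swap 1 2, swap 0 1 * swap 1 2 * swap 2 3 * swap 3 4]
    let cls : Fin 28 → Fin 3 :=
      ![0, 0, 0, 0, 0, 0, 0, 0, 0, 0, 0, 0, 0, 0, 1, 1, 1, 1, 1, 1, 1, 1, 1, 2, 2, 2, 2, 2]
    let cj : Fin 28 → Perm (Fin 5) :=
      ![swap 0 1 * swap 0 2, swap 0 1 * swap 0 3, swap 0 1 * swap 0 4, swap 0 1 * swap 1 4, swap 0 1 * swap 2 4,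
        swap 0 1 * swap 3 4, swap 0 2 * swap 0 4, swap 0 2 * swap 1 4, swap 0 2 * swap 2 4, swap 0 2 * swap 3 4,
        swap 0 3 * swap 0 4, swap 0 3 * swap 1 4, swap 0 3 * swap 2 4, swap 0 3 * swap 3 4,
        swap 0 1 * swap 0 3, swap 0 1 * swap 0 4, swap 0 1 * swap 1 3, swap 0 1 * swap 1 4, swap 0 1 * swap 2 3,
        swap 0 1 * swap 2 4, swap 0 3 * swap 1 4, swap 0 3 * swap 2 4, swap 1 3 * swap 2 4,
        swap 0 1 * swap 0 2, swap 0 1 * swap 0 3, swap 0 1 * swap 0 4, swap 0 1 * swap 1 4, swap 0 2 * swap 1 4]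
    let ord : Fin 3 → ℕ := ![2, 3, 5]
    let gen : Fin 3 ⊕ Fin 28 → Perm (Fin 5) := Sum.elim base fun j ↦ cj j * base (cls j) * (cj j)⁻¹
    let ordι : Fin 3 ⊕ Fin 28 → ℕ := Sum.elim ord fun j ↦ ord (cls j)
    (∀ i, gen i ^ ordι i = 1) ∧ (∀ k, Perm.sign (base k) = 1) ∧ (∀ j, Perm.sign (cj j) = 1) ∧
      (∀ x : Perm (Fin 5), Perm.sign x = 1 → ∃ i, ∃ n : Fin (ordι i), gen i ^ (n : ℕ) = x) ∧
      (∀ i j, i ≠ j → ∀ a : Fin (ordι i), ∀ b : Fin (ordι j),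
        gen i ^ (a : ℕ) = gen j ^ (b : ℕ) → gen i ^ (a : ℕ) = 1) := by
  refine ⟨?_, ?_, ?_, ?_, ?_⟩
  · decide +kernel
  · decide +kernel
  · decide +kernel
  · decide +kernel
  · decide +kernel

/-- The class sizes of the `A₅` partition: `15` subgroups generated by double transpositions, `10` Sylow
`3`-subgroups, `6` Sylow `5`-subgroups. [cite: GaronziDias2019, §7 (element orders of S_5: 20 of order 3, 24 of order 5)] -/
theorem a5_card_classes :
    let cls : Fin 28 → Fin 3 :=
      ![0, 0, 0, 0, 0, 0, 0, 0, 0, 0, 0, 0, 0, 0, 1, 1, 1, 1, 1, 1, 1, 1, 1, 2, 2, 2, 2, 2]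
    let clsι : Fin 3 ⊕ Fin 28 → Fin 3 := Sum.elim id cls
    (∀ k : Fin 3, Fintype.card {i // clsι i = k} = (![15, 10, 6] : Fin 3 → ℕ) k) := by
  decide +kernel

/-- The orders `2, 3, 5` of the representatives `(0 1)(2 3)`, `(0 1 2)`, `(0 1 2 3 4)` as elements of
`↥(alternatingGroup (Fin 5))`, as cardinalities of the cyclic subgroups of `A₅` they generate.
[cite: GaronziDias2019, §7] -/
theorem a5_card_zpowers :
    Fintype.card (Subgroup.zpowers
        (⟨swap (0 : Fin 5) 1 * swap 2 3, Perm.mem_alternatingGroup.2 (by decide)⟩ : alternatingGroup (Fin 5))) = 2 ∧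
      Fintype.card (Subgroup.zpowers
        (⟨swap (0 : Fin 5) 1 * swap 1 2, Perm.mem_alternatingGroup.2 (by decide)⟩ : alternatingGroup (Fin 5))) = 3 ∧
      Fintype.card (Subgroup.zpowers
        (⟨swap (0 : Fin 5) 1 * swap 1 2 * swap 2 3 * swap 3 4, Perm.mem_alternatingGroup.2 (by decide)⟩ :
          alternatingGroup (Fin 5))) = 5 := by
  refine ⟨?_, ?_, ?_⟩
  · rw [Fintype.card_zpowers, Subgroup.orderOf_mk, orderOf_eq_prime_iff (p := 2)]
    decide
  · rw [Fintype.card_zpowers, Subgroup.orderOf_mk, orderOf_eq_prime_iff (p := 3)]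
    decide
  · haveI : Fact (Nat.Prime 5) := ⟨by norm_num⟩
    rw [Fintype.card_zpowers, Subgroup.orderOf_mk, orderOf_eq_prime_iff (p := 5)]
    decide

/-- `|A₅| = 60` (`2 · |A₅| = |S₅| = 120`). [cite: GaronziDias2019, §7] -/
theorem card_alternatingGroup_fin_five : Fintype.card (alternatingGroup (Fin 5)) = 60 := by
  have h := two_mul_card_alternatingGroup (α := Fin 5)
  rw [Fintype.card_perm, Fintype.card_fin] at h
  have h5 : Nat.factorial 5 = 120 := rfl
  omega

end SymmetricGroupPartition

namespace AbelianVariety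

/-! ### §4 `A₅`: `B_{(01)(23)} × B_{(012)} × B_{(01234)} ∼ X × B_{A₅}²` -/

section AltFive

open SymmetricGroupPartition

variable {K : Type u} [Field K] {X : AbelianVariety K} (ρ : alternatingGroup (Fin 5) →* End X)
  {N₂ N₃ N₅ NG : X ⟶ X}

/-- **Kani–Rosen Theorem B for `A₅ ≅ PSL₂(5)` equipped by the partition into its `31` subgroups of prime order — the
Hom counts (any field)**: for an action `ρ` of `↥(alternatingGroup (Fin 5))` on `X`, with `N₂, N₃, N₅` the norm
endomorphisms of `⟨(0 1)(2 3)⟩`, `⟨(0 1 2)⟩`, `⟨(0 1 2 3 4)⟩` and `N_G = Σ_g ρ(g)`, for every `B`: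
**`rk Hom(B_{C₂}, B) + rk Hom(B_{C₃}, B) + rk Hom(B_{C₅}, B) = rk Hom(X, B) + 2 · rk Hom(B_{A₅}, B)`** — Theorem B's
counts with `t = 31`, `|G| = 60`, classes `15·2 = 10·3 = 6·5 = 30`, divided by `30`.
[cite: KorchmarosLiaTimpanella2021, §10 Thm. 10.1 (32)] [cite: KaniRosen1989, Thm. B]
[cite: GaronziDias2019, §1 ("PSL_2(p^m) with p^m ≥ 4") and §7] -/
theorem finrank_hom_altFive
    (hN₂ : End.of N₂ = ∑ h : Subgroup.zpowers (⟨swap (0 : Fin 5) 1 * swap 2 3,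
      Perm.mem_alternatingGroup.2 (by decide)⟩ : alternatingGroup (Fin 5)), ρ h)
    (hN₃ : End.of N₃ = ∑ h : Subgroup.zpowers (⟨swap (0 : Fin 5) 1 * swap 1 2,
      Perm.mem_alternatingGroup.2 (by decide)⟩ : alternatingGroup (Fin 5)), ρ h)
    (hN₅ : End.of N₅ = ∑ h : Subgroup.zpowers (⟨swap (0 : Fin 5) 1 * swap 1 2 * swap 2 3 * swap 3 4,
      Perm.mem_alternatingGroup.2 (by decide)⟩ : alternatingGroup (Fin 5)), ρ h)
    (hNG : End.of NG = ∑ g, ρ g) (B : AbelianVariety K) :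
    Module.finrank ℤ (image N₂ ⟶ B) + Module.finrank ℤ (image N₃ ⟶ B) + Module.finrank ℤ (image N₅ ⟶ B) =
      Module.finrank ℤ (X ⟶ B) + 2 * Module.finrank ℤ (image NG ⟶ B) := by
  classical
  obtain ⟨hord, hsb, hsc, hcov, hdis⟩ := a5_pow_tables
  have hcls := a5_card_classes
  obtain ⟨c2, c3, c5⟩ := a5_card_zpowers
  -- the partition data, on `Perm (Fin 5)` and lifted to `↥(alternatingGroup (Fin 5))`
  let base : Fin 3 → Perm (Fin 5) :=
    ![swap 0 1 * swap 2 3, swap 0 1 * swap 1 2, swap 0 1 * swap 1 2 * swap 2 3 * swap 3 4]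
  let cls : Fin 28 → Fin 3 :=
    ![0, 0, 0, 0, 0, 0, 0, 0, 0, 0, 0, 0, 0, 0, 1, 1, 1, 1, 1, 1, 1, 1, 1, 2, 2, 2, 2, 2]
  let cj : Fin 28 → Perm (Fin 5) :=
    ![swap 0 1 * swap 0 2, swap 0 1 * swap 0 3, swap 0 1 * swap 0 4, swap 0 1 * swap 1 4, swap 0 1 * swap 2 4,
      swap 0 1 * swap 3 4, swap 0 2 * swap 0 4, swap 0 2 * swap 1 4, swap 0 2 * swap 2 4, swap 0 2 * swap 3 4,
      swap 0 3 * swap 0 4, swap 0 3 * swap 1 4, swap 0 3 * swap 2 4, swap 0 3 * swap 3 4,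
      swap 0 1 * swap 0 3, swap 0 1 * swap 0 4, swap 0 1 * swap 1 3, swap 0 1 * swap 1 4, swap 0 1 * swap 2 3,
      swap 0 1 * swap 2 4, swap 0 3 * swap 1 4, swap 0 3 * swap 2 4, swap 1 3 * swap 2 4,
      swap 0 1 * swap 0 2, swap 0 1 * swap 0 3, swap 0 1 * swap 0 4, swap 0 1 * swap 1 4, swap 0 2 * swap 1 4]
  let ord : Fin 3 → ℕ := ![2, 3, 5]
  let gen : Fin 3 ⊕ Fin 28 → Perm (Fin 5) := Sum.elim base fun j ↦ cj j * base (cls j) * (cj j)⁻¹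
  let ordι : Fin 3 ⊕ Fin 28 → ℕ := Sum.elim ord fun j ↦ ord (cls j)
  let baseA : Fin 3 → alternatingGroup (Fin 5) := fun k ↦ ⟨base k, Perm.mem_alternatingGroup.2 (hsb k)⟩
  let cjA : Fin 28 → alternatingGroup (Fin 5) := fun j ↦ ⟨cj j, Perm.mem_alternatingGroup.2 (hsc j)⟩
  let genA : Fin 3 ⊕ Fin 28 → alternatingGroup (Fin 5) :=
    Sum.elim baseA fun j ↦ cjA j * baseA (cls j) * (cjA j)⁻¹
  let H : Fin 3 ⊕ Fin 28 → Subgroup (alternatingGroup (Fin 5)) := fun i ↦ Subgroup.zpowers (genA i)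
  let clsι : Fin 3 ⊕ Fin 28 → Fin 3 := Sum.elim id cls
  let rep : Fin 3 → Fin 3 ⊕ Fin 28 := Sum.inl
  let g : Fin 3 ⊕ Fin 28 → alternatingGroup (Fin 5) := Sum.elim (fun _ ↦ 1) cjA
  let Nf : Fin 3 ⊕ Fin 28 → (X ⟶ X) := Sum.elim ![N₂, N₃, N₅] fun j ↦ End.asHom (∑ h : H (Sum.inr j), ρ h)
  have hgenA : ∀ i, (genA i : Perm (Fin 5)) = gen i := by
    rintro (k | j)
    · rfl
    · rfl
  have hord0 : ∀ i, 0 < ordι i := by decide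
  -- membership in `H i` read on `Perm (Fin 5)`
  have hmem : ∀ i (x : alternatingGroup (Fin 5)), x ∈ H i → (x : Perm (Fin 5)) ∈ Subgroup.zpowers (gen i) := by
    intro i x hx
    obtain ⟨k, hk⟩ := Subgroup.mem_zpowers_iff.1 hx
    exact Subgroup.mem_zpowers_iff.2 ⟨k, by rw [← hgenA i, ← SubgroupClass.coe_zpow, hk]⟩
  have hcover : ∀ x : alternatingGroup (Fin 5), ∃ i, x ∈ H i := fun x ↦ by
    obtain ⟨i, n, hn⟩ := hcov x.1 (Perm.mem_alternatingGroup.1 x.2)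
    have hn' : genA i ^ (n : ℕ) = x := Subtype.ext (by rw [SubgroupClass.coe_pow, hgenA i, hn])
    exact ⟨i, hn' ▸ Subgroup.npow_mem_zpowers (genA i) n⟩
  have hdisj : ∀ i j, i ≠ j → ∀ x : alternatingGroup (Fin 5), x ∈ H i → x ∈ H j → x = 1 :=
    fun i j hij x hi hj ↦ Subtype.ext
      (eq_one_of_mem_zpowers_of_mem_zpowers gen ordι hord0 hord hdis hij (hmem i x hi) (hmem j x hj))
  have hconj : ∀ i x, x ∈ H i ↔ (g i)⁻¹ * x * g i ∈ H (rep (clsι i)) := by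
    rintro (k | j) x
    · exact mem_iff_one_conj_mem _ x
    · exact mem_zpowers_conj_iff _ _ x
  have hNf : ∀ i, End.of (Nf i) = ∑ h : H i, ρ h := by
    rintro (k | j)
    · fin_cases k
      · exact hN₂
      · exact hN₃
      · exact hN₅
    · rfl
  have key := sum_card_fiber_mul_finrank_hom_image_eq_of_partition ρ H clsι rep g hcover hdisj hNf hNG hconj B
  rw [Fin.sum_univ_three, hcls 0, hcls 1, hcls 2, Fintype.card_sum, Fintype.card_fin, Fintype.card_fin,
    card_alternatingGroup_fin_five] at key
  have e2 : Fintype.card (H (rep 0)) = 2 := c2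
  have e3 : Fintype.card (H (rep 1)) = 3 := c3
  have e5 : Fintype.card (H (rep 2)) = 5 := c5
  rw [e2, e3, e5] at key
  have r2 : Module.finrank ℤ (image (Nf (rep 0)) ⟶ B) = Module.finrank ℤ (image N₂ ⟶ B) := rfl
  have r3 : Module.finrank ℤ (image (Nf (rep 1)) ⟶ B) = Module.finrank ℤ (image N₃ ⟶ B) := rfl
  have r5 : Module.finrank ℤ (image (Nf (rep 2)) ⟶ B) = Module.finrank ℤ (image N₅ ⟶ B) := rfl
  rw [r2, r3, r5] at key
  simp only [Matrix.cons_val_zero, Matrix.cons_val_one, Matrix.cons_val] at key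
  omega

variable [PerfectField K]

/-- **The Kani–Rosen relation of `A₅ ≅ PSL₂(5)`: `X × B_{A₅}² ∼ B_{C₂} × B_{C₃} × B_{C₅}`** (perfect field) — for a
Jacobian with `A₅`-action `J_C × J²_{C/A₅} ∼ J_{C/⟨(01)(23)⟩} × J_{C/⟨(012)⟩} × J_{C/⟨(01234)⟩}`: Theorem B (32) for the
`31`-component partition (`X^{30} × B_G^{60} ∼ B_{C₂}^{30} × B_{C₃}^{30} × B_{C₅}^{30}`), conjugate components identified
and the exponents divided by `30`. [cite: KorchmarosLiaTimpanella2021, §10 Thm. 10.1 (32)–(33)] [cite: KaniRosen1989, Thm. B]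
[cite: GaronziDias2019, §1 and §7] -/
theorem isIsogenous_altFive
    (hN₂ : End.of N₂ = ∑ h : Subgroup.zpowers (⟨swap (0 : Fin 5) 1 * swap 2 3,
      Perm.mem_alternatingGroup.2 (by decide)⟩ : alternatingGroup (Fin 5)), ρ h)
    (hN₃ : End.of N₃ = ∑ h : Subgroup.zpowers (⟨swap (0 : Fin 5) 1 * swap 1 2,
      Perm.mem_alternatingGroup.2 (by decide)⟩ : alternatingGroup (Fin 5)), ρ h)
    (hN₅ : End.of N₅ = ∑ h : Subgroup.zpowers (⟨swap (0 : Fin 5) 1 * swap 1 2 * swap 2 3 * swap 3 4,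
      Perm.mem_alternatingGroup.2 (by decide)⟩ : alternatingGroup (Fin 5)), ρ h)
    (hNG : End.of NG = ∑ g, ρ g) :
    IsIsogenous (X ⊞ (image NG ⊞ image NG)) (image N₂ ⊞ (image N₃ ⊞ image N₅)) := by
  refine isIsogenous_iff_forall_finrank_hom_eq'.2 fun B ↦ ?_
  rw [finrank_hom_biprod, finrank_hom_biprod, finrank_hom_biprod, finrank_hom_biprod]
  have h := finrank_hom_altFive ρ hN₂ hN₃ hN₅ hNG B
  omega

/-- **Dimensions in the `A₅` relation: `dim X + 2 dim B_{A₅} = dim B_{C₂} + dim B_{C₃} + dim B_{C₅}`** (for Jacobians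
`g + 2 g_{A₅} = g_{C₂} + g_{C₃} + g_{C₅}`; perfect field). [cite: KorchmarosLiaTimpanella2021, §10 Thm. 10.1 (32)]
[cite: KaniRosen1989, Thm. B] -/
theorem dim_altFive
    (hN₂ : End.of N₂ = ∑ h : Subgroup.zpowers (⟨swap (0 : Fin 5) 1 * swap 2 3,
      Perm.mem_alternatingGroup.2 (by decide)⟩ : alternatingGroup (Fin 5)), ρ h)
    (hN₃ : End.of N₃ = ∑ h : Subgroup.zpowers (⟨swap (0 : Fin 5) 1 * swap 1 2,
      Perm.mem_alternatingGroup.2 (by decide)⟩ : alternatingGroup (Fin 5)), ρ h)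
    (hN₅ : End.of N₅ = ∑ h : Subgroup.zpowers (⟨swap (0 : Fin 5) 1 * swap 1 2 * swap 2 3 * swap 3 4,
      Perm.mem_alternatingGroup.2 (by decide)⟩ : alternatingGroup (Fin 5)), ρ h)
    (hNG : End.of NG = ∑ g, ρ g) :
    X.dim + 2 * (image NG).dim = (image N₂).dim + (image N₃).dim + (image N₅).dim := by
  have h := (isIsogenous_altFive ρ hN₂ hN₃ hN₅ hNG).dim_eq
  rw [dim_biprod, dim_biprod, dim_biprod, dim_biprod] at h
  omega

/-- **`B_{A₅} = 0`: `X ∼ B_{C₂} × B_{C₃} × B_{C₅}`** (perfect field). [cite: KorchmarosLiaTimpanella2021, §10 Thm. 10.1 and (33) ("since V/G is rational")]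
[cite: KaniRosen1989, Thm. B] -/
theorem isIsogenous_altFive_of_dim_eq_zero
    (hN₂ : End.of N₂ = ∑ h : Subgroup.zpowers (⟨swap (0 : Fin 5) 1 * swap 2 3,
      Perm.mem_alternatingGroup.2 (by decide)⟩ : alternatingGroup (Fin 5)), ρ h)
    (hN₃ : End.of N₃ = ∑ h : Subgroup.zpowers (⟨swap (0 : Fin 5) 1 * swap 1 2,
      Perm.mem_alternatingGroup.2 (by decide)⟩ : alternatingGroup (Fin 5)), ρ h)
    (hN₅ : End.of N₅ = ∑ h : Subgroup.zpowers (⟨swap (0 : Fin 5) 1 * swap 1 2 * swap 2 3 * swap 3 4,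
      Perm.mem_alternatingGroup.2 (by decide)⟩ : alternatingGroup (Fin 5)), ρ h)
    (hNG : End.of NG = ∑ g, ρ g) (h0 : (image NG).dim = 0) :
    IsIsogenous X (image N₂ ⊞ (image N₃ ⊞ image N₅)) := by
  refine isIsogenous_iff_forall_finrank_hom_eq'.2 fun B ↦ ?_
  rw [finrank_hom_biprod, finrank_hom_biprod]
  have h := finrank_hom_altFive ρ hN₂ hN₃ hN₅ hNG B
  haveI : Subsingleton (image NG ⟶ B) := ⟨fun f f' ↦ by
    rw [hom_eq_zero_of_dim_eq_zero_left (image NG) h0 f, hom_eq_zero_of_dim_eq_zero_left (image NG) h0 f']⟩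
  have hz : Module.finrank ℤ (image NG ⟶ B) = 0 := Module.finrank_zero_of_subsingleton
  omega

end AltFive

end AbelianVariety

end Literature.AlgebraicGeometry.Motives
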